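import Literature.NumberTheory.GaloisCohomology.Howard2004.PiAdicRefinementH3Proofs
import Literature.NumberTheory.EllipticCurves.ZpExtensionEisensteinPiRefinementCurve
import HarnessLib

/-!
# Howard's H.3 for `F_𝔮` on the curve's Eisenstein tower at the bad places `v ∤ p` (saturated unramified cores),
# over the level ring `A_{m,k+1}` (theorems only; no definition, no named fact, no `sorry`)

Topic `NumberTheory/EllipticCurves` (D1 road of cell `pub/bsd-print-x9`, `DVRSetting.SatisfiesH.h3` for the §1.6 assembly
`WeierstrassCurve.eisensteinDVRSetting` of `ZpExtensionEisensteinDVRSetting`).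

B. Howard, Compositio Math. 140 (2004), Hypothesis H.3 (arXiv:1202.6340 p. 7 L65–67) for `F_𝔮` (Def. 3.1.2): «the local
condition `F` at `v` is cartesian on `Quot(T)`» — for `F_𝔮` «this follows from Lemma 3.7.1 of [MR04] and the fact that `F_𝔮`
on `T_𝔮` is obtained by propagation from `V_𝔮`» (p. 16 L1–3).  At a place `v ∈ S` with `v ∤ p` the tree's `F_𝔮` at level
`k+1` is `Tower.levelCondition` of the local `p`-adic tower with UNRAMIFIED cores
(`eisensteinSelmerStructure_inr_of_mem_of_not_mem`).  This file proves, for every level `k` of the curve's tower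
`W.eisensteinTower κ hm` (`= eisensteinAdicTowerSucc`, level `k` = torsion level `k+1`) and every such `v`:

**`WeierstrassCurve.isCartesianOnQuotAt_eisensteinSelmerStructure_of_not_mem`** :
`IsCartesianOnQuotAt ((W.eisensteinTower κ hm).ρ k) (EisensteinCoeff p m (k+1)) (Sum.inr v) (F_𝔮 (k+1) (Sum.inr v))`
— the `v ∤ p` finite-place clause of `SatisfiesH.h3` for `W.eisensteinDVRSetting …` (whose `(t k).cond` is this `F_𝔮`,
`eisensteinDVRSetting_t_cond`), by `PiRefinementDatum.isCartesianOnQuotAt_levelCondition_of_finite`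
(`Howard2004/PiAdicRefinementH3Proofs`) on the curve's refinement datum (`ZpExtensionEisensteinPiRefinementCurve`) with
cores `H¹_ur` (compatibilities: `galoisCohomology.map_unramifiedSubgroup_le / _eq_of_bijective`), the level ring `A_{m,k+1}`
(`algebraOfSpec`, H.0 freeness, `isPrincipalArtinianOfLength`, `maximalIdeal_eisensteinCoeff_eq`), the `A`-stability
`isScalarStable_eisensteinSelmerStructure`, and the identification of the datum's one-step local reductions with
`eisensteinLocalReduce` (`eisensteinPiRefinementDatum_red_succ`).  The places `v ∣ p` (ordinary cores) and the archimedean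
places are NOT treated here.  Nothing about Selmer groups of `E` is asserted; BSD is not proved by any of this.

References: [Howard2004HeegnerKolyvagin] H.3, Def. 1.1.2–1.1.3, Rem. 1.1.4, §1.6, Def. 3.1.2 (arXiv p. 5, p. 7 L65–67, p. 12,
p. 15–16); [MazurRubinMemoirs2004] Lemma 3.7.1; [MilneADT2006] I §2.
-/

set_option autoImplicit false

noncomputable section

open Function NumberField IsDedekindDomain Field
open scoped NumberField ContRepresentation Classical Pointwise TensorProduct


namespace WeierstrassCurve

open Literature.NumberTheory.EllipticCurves Literature.NumberTheory.GaloisRepresentations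
open Literature.NumberTheory.GaloisRepresentations.DiscreteGaloisModule
open Literature.NumberTheory.EllipticCurves.ZpExtension (EisensteinLevel)
open Literature.NumberTheory.GaloisCohomology.Howard2004

variable {K : Type} [Field K] [NumberField K] (E : WeierstrassCurve K) [E.IsElliptic] {p : ℕ} [hp : Fact p.Prime]
  (κ : Literature.NumberTheory.EllipticCurves.ZpExtension K p) {m : ℕ} (hm : 1 ≤ m)

/-! ## §1 Bookkeeping for the curve's datum at a finite place -/

omit [NumberField K] in
include hm in
/-- The levels `E[p^j] ⊗ A_{m,j}` are finite. [cite: Howard2004HeegnerKolyvagin, §2.2 and Lemma 2.2.7] -/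
theorem finite_eisensteinLevel_geomTorsion (j : ℕ) : Finite (EisensteinLevel p m (fun j ↦ geomTorsion E ((p : ℤ) ^ j)) j) := by
  haveI : Finite (geomTorsion E ((p : ℤ) ^ j)) :=
    finite_torsionPoints_holds E (AlgebraicClosure K) (pow_ne_zero _ (by exact_mod_cast hp.out.ne_zero))
  exact IwasawaAlgebra.EisensteinCoeff.finite_twisted (p := p) (k := j) hm

/-- The refinement levels `T/π^iT` of the curve's datum are finite (quotients of finite levels).
[cite: Howard2004HeegnerKolyvagin, §1.6 (arXiv p. 12)] -/
theorem finite_eisensteinPiRefinementDatum_level (a : ℕ) : Finite ((E.eisensteinPiRefinementDatum κ hm).Level a) := by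
  haveI := E.finite_eisensteinLevel_geomTorsion (p := p) hm ((E.eisensteinPiRefinementDatum κ hm).host a)
  exact Finite.of_surjective _ (Submodule.mkQ_surjective _)

/-- `p ∈ (π)` in `S_𝔮` (`p = -π^m`, `m ≥ 1`). [cite: Howard2004HeegnerKolyvagin, proof of Thm. 2.2.10 (𝔮 = T^m + p)] [cite: Washington1997, §13.2] -/
theorem natCast_mem_span_pi :
    ((p : ℕ) : IwasawaAlgebra p ⧸
        Ideal.span {(PowerSeries.X ^ m + PowerSeries.C (p : ℤ_[p]) : IwasawaAlgebra p)}) ∈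
      Ideal.span {(E.eisensteinPiRefinementDatum κ hm).π} := by
  rw [E.eisensteinPiRefinementDatum_π κ hm, IwasawaAlgebra.natCast_eq_neg_mk_X_pow_quotient_X_pow_add_C p m,
    Ideal.neg_mem_iff]
  exact Ideal.pow_mem_of_mem _ (Ideal.mem_span_singleton_self _) m hm

/-- **The datum's one-step local reductions ARE the `F_𝔮` tower's `eisensteinLocalReduce`** (same
`eisensteinTwistReduce`, `torsionGaloisModuleReduceLE_succ`). [cite: Howard2004HeegnerKolyvagin, §2.2 and Lemma 3.2.7] -/
theorem redH_eisensteinPiRefinementDatum_eq_eisensteinLocalReduce (v : HeightOneSpectrum (𝓞 K)) (j : ℕ) :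
    (E.eisensteinPiRefinementDatum κ hm).redH v (Nat.le_succ j) =
      κ.eisensteinLocalReduce (fun j ↦ E.torsionGaloisModule ((p : ℤ) ^ j)) (fun j ↦ E.torsionGaloisModuleReduce p j) hm
        (Sum.inr v) j := by
  refine AddMonoidHom.ext fun c ↦ ?_
  have h1 := galoisCohomology.map_map_of_comp_apply
    (localIntertwining ((E.eisensteinPiRefinementDatum κ hm).ρ (j + 1)) ((E.eisensteinPiRefinementDatum κ hm).ρ j) v
      ((E.eisensteinPiRefinementDatum κ hm).red (Nat.le_succ j)).toAddMonoidHom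
      ((E.eisensteinPiRefinementDatum κ hm).red_equivariant_toLocal v (Nat.le_succ j)))
    (ContIntertwiningMap.id)
    (DiscreteGaloisModule.localMap
      (κ.eisensteinTwistReduce hm (Nat.le_succ j) (E.torsionGaloisModuleReduce p j)) (Sum.inr v))
    (fun x ↦ ?_) c
  · rw [Literature.NumberTheory.EllipticCurves.Tower.map_apply_eq_self_of_forall_apply_eq _ (fun _ ↦ rfl)] at h1
    exact h1
  · change κ.eisensteinTwistReduce hm (Nat.le_succ j) (E.torsionGaloisModuleReduce p j) _ =
      (E.eisensteinPiRefinementDatum κ hm).red (Nat.le_succ j) x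
    rw [E.eisensteinPiRefinementDatum_red_succ κ hm j x]

/-! ## §2 H.3 at the places `v ∈ S`, `v ∤ p` -/

/-- **Howard's H.3 for `F_𝔮` at a place `v ∤ p` of `S`, over the level ring `A_{m,k+1}`**: for the curve's Eisenstein
tower `W.eisensteinTower κ hm` (level `k` = `E_K[p^{k+1}] ⊗ A_{m,k+1}(ψ)`, `E_K = W.baseChange K`) the saturated unramified
level condition `F_𝔮 (k+1) (Sum.inr v)` is cartesian on `Quot(T^{(k)})` in the verbatim sense of `IsCartesianOnQuotAt`.
[cite: Howard2004HeegnerKolyvagin, H.3 with Def. 1.1.2–1.1.3 and Def. 3.1.2 (arXiv p. 7 L65–67, p. 5 L88–99, p. 16 L1–3)]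
[cite: MazurRubinMemoirs2004, Lemma 3.7.1] -/
theorem isCartesianOnQuotAt_eisensteinSelmerStructure_of_not_mem (W : WeierstrassCurve ℚ) [W.IsElliptic]
    (S : Finset (HeightOneSpectrum (𝓞 K)))
    (Φ : ∀ v : HeightOneSpectrum (𝓞 K), ((p : ℕ) : 𝓞 K) ∈ v.asIdeal →
      ZpExtension.OrdinaryFiltration (fun j ↦ (W.baseChange K).torsionGaloisModule ((p : ℤ) ^ j))
        (fun j ↦ (W.baseChange K).torsionGaloisModuleReduce p j) v)
    (k : ℕ) {v : HeightOneSpectrum (𝓞 K)} (hv : ((p : ℕ) : 𝓞 K) ∉ v.asIdeal) (hvS : v ∈ S) :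
    letI := IwasawaAlgebra.isLocalRing_quotient_X_pow_add_C p hm
    IsCartesianOnQuotAt ((W.eisensteinTower κ hm).ρ k) (IwasawaAlgebra.EisensteinCoeff p m (k + 1)) (Sum.inr v)
      (κ.eisensteinSelmerStructure (fun j ↦ (W.baseChange K).torsionGaloisModule ((p : ℤ) ^ j))
        (fun j ↦ (W.baseChange K).torsionGaloisModuleReduce p j) hm S Φ (k + 1) (Sum.inr v)) := by
  letI := IwasawaAlgebra.isLocalRing_quotient_X_pow_add_C p hm
  set D := (W.baseChange K).eisensteinPiRefinementDatum κ hm with hD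
  -- the level ring `A = A_{m,k+1}` acting through `S_𝔮 → A`
  letI := IwasawaAlgebra.EisensteinCoeff.algebraOfSpec p m (k + 1)
  haveI := ZpExtension.EisensteinLevel.isScalarTower_algebraOfSpec p m
    (fun j ↦ geomTorsion (W.baseChange K) ((p : ℤ) ^ j)) (k + 1)
  haveI := IwasawaAlgebra.EisensteinCoeff.isLocalRing_eisensteinCoeff p hm k.succ_pos
  haveI : Module.Free (IwasawaAlgebra.EisensteinCoeff p m (k + 1))
      (EisensteinLevel p m (fun j ↦ geomTorsion (W.baseChange K) ((p : ℤ) ^ j)) (k + 1)) :=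
    (W.baseChange K).free_eisensteinLevel_geomTorsion (p := p) (m := m) (k + 1)
  haveI : ∀ a, Finite (D.Level a) := fun a ↦ (W.baseChange K).finite_eisensteinPiRefinementDatum_level κ hm a
  have hlinA : (D.ρ (k + 1)).IsScalarLinear (IwasawaAlgebra.EisensteinCoeff p m (k + 1)) :=
    κ.isScalarLinear_eisensteinTwist ((W.baseChange K).torsionGaloisModule ((p : ℤ) ^ (k + 1))) hm (k + 1)
  -- the condition as the datum's level condition with unramified cores
  rw [κ.eisensteinSelmerStructure_inr_of_mem_of_not_mem _ _ hm S Φ (k + 1) hv hvS]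
  have hred : (κ.eisensteinLocalReduce (fun j ↦ (W.baseChange K).torsionGaloisModule ((p : ℤ) ^ j))
      (fun j ↦ (W.baseChange K).torsionGaloisModuleReduce p j) hm (Sum.inr v)) =
      fun j ↦ D.redH v (Nat.le_succ j) :=
    funext fun j ↦ ((W.baseChange K).redH_eisensteinPiRefinementDatum_eq_eisensteinLocalReduce κ hm v j).symm
  rw [hred]
  -- the maximal ideal of `A` in the `algebraMap` spelling
  have hmaxA : IsLocalRing.maximalIdeal (IwasawaAlgebra.EisensteinCoeff p m (k + 1)) =
      Ideal.span {algebraMap (IwasawaAlgebra p ⧸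
        Ideal.span {(PowerSeries.X ^ m + PowerSeries.C (p : ℤ_[p]) : IwasawaAlgebra p)})
        (IwasawaAlgebra.EisensteinCoeff p m (k + 1)) D.π} := by
    rw [IwasawaAlgebra.EisensteinCoeff.maximalIdeal_eisensteinCoeff_eq p hm k.succ_pos]
    rfl
  refine D.isCartesianOnQuotAt_levelCondition_of_finite v hlinA p
    (fun j ↦ unramifiedSubgroup (GaloisRep.toLocal v (D.ρ j)) 1) hm
    (fun j ↦ (W.baseChange K).eisensteinPiRefinementDatum_host_mul_le κ hm j) (fun j ↦ rfl)
    ((W.baseChange K).natCast_mem_span_pi κ hm)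
    (fun a ↦ unramifiedSubgroup (GaloisRep.toLocal v (D.levelRep a)) 1)
    (fun a b _ w hw ↦ galoisCohomology.map_unramifiedSubgroup_le _ ⟨w, hw, rfl⟩)
    (fun a r y hy ↦ galoisCohomology.map_unramifiedSubgroup_le _ ⟨y, hy, rfl⟩)
    (fun j ↦ galoisCohomology.map_unramifiedSubgroup_eq_of_bijective _
      (D.proj_bijective ((W.baseChange K).eisensteinPiRefinementDatum_host_mul_le κ hm j) rfl))
    hmaxA (IwasawaAlgebra.EisensteinCoeff.isPrincipalArtinianOfLength (p := p) hm k.succ_pos) ?_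
  -- `A`-stability of the condition (`isScalarStable_eisensteinSelmerStructure`)
  intro a
  rintro _ ⟨x, hx, rfl⟩
  have hstab := κ.isScalarStable_eisensteinSelmerStructure
    (fun j ↦ (W.baseChange K).torsionGaloisModule ((p : ℤ) ^ j))
    (fun j ↦ (W.baseChange K).torsionGaloisModuleReduce p j) hm S Φ (k + 1) (Sum.inr v) a
    (x := x) (by
      rw [κ.eisensteinSelmerStructure_inr_of_mem_of_not_mem _ _ hm S Φ (k + 1) hv hvS, hred]
      exact hx)
  rw [κ.eisensteinSelmerStructure_inr_of_mem_of_not_mem _ _ hm S Φ (k + 1) hv hvS, hred] at hstab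
  exact hstab


end WeierstrassCurve

end
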